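import Summits.QuantumFields.BalabanUV.T4Continuum.Support.NE3HatInvCurlLetters
import Summits.QuantumFields.BalabanUV.T4Continuum.Support.NE3RightInverseL2Letter
import Summits.QuantumFields.BalabanUV.T4Continuum.Support.NE3RightInverseL1Letter
import HarnessLib

/-!
# T⁴ programme, node NE3 — route Π, row Π-R (curved step), file Π-R-W6z: THE LETTERS OF THE EXACT CURVED RIGHT INVERSE, ASSEMBLED —
# exactness, skewness, periodicity `(N·L^{k+1})`, and (R1)–(R5), (R6′) for `rightInvW … φ` in the currency of the route-Π junction, k-FREE, N-FREE

NE3 (node U1b) formalisation swarm, leaf seat `b2b-balaban-t4-ne3-formalise-leaf-01` (gen 8); row Π-R-W, ruling ρ-g25-1 (2) («`dirIter L (j+1) W (R_W φ) = φ`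
EXACT, θ < 1 only» + letters (R1)–(R5), (R6′) k-free) — THE ASSEMBLY.  The junction of record (`NE3DecomposedRepOfQuadLetter.decomposedRep_of_quadLetter`,
owner g26) consumes, for its linear normal part `Nn`, periodicity `IsPeriodicDir Nn (N * L^(j+1))`, a sup `αN`, a window sup-curl `aN`, and (R1)–(R4)
against `φ := dirIter L (j+1) W X₀` over `periodBox (N * L^(j+1))` ∕ `periodBox N`.  Here every one of these is stated for `rightInvW hL k hWu hx hs hWx N hθ hφ`
token for token (the three ℓ-letters (R1) W6b `dirSq_rightInvW_le`, (R4) W6d `dirL1_rightInvW_le`, (R5) W6a `norm_rightInvW_le` are re-exported by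
name; the curl letters (R2)(R3)(R6′) are composed here from W6c's `hatInvW` letters and W6b⁰'s solve letters), under ONE class of hypotheses:
`2 ≤ L`, unitary `W` of period `tower L N (k+1)`, `0 ≤ x`, `LevelSmall d L k x`, `SmallField W x`, the smallness binders `θ := cruxC·ε < 1`,
`θ_loc := thetaLoc·ε < 1` and the regime letter `ε := (L^{k+1})²·x ≤ 1`, `φ` skew (and `N`-periodic for exactness).  HONEST: `rightInvW` is NOT
frame-free and NOT Ξ₀₀-orthogonal — the junction's `ResidualSliceRepT.tangent` needs the normalised `R♮ = R_W + gaugeDir W μ` of D-ne3p1-g25-1 §4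
file 3c, whose letters are these plus the normalising generator's.

CONTENT ([folklore]; 0 sorry; 0 def): §1 exactness ∕ skewness ∕ periodicity in junction spelling; §2 the curl letters (R2), (R3), (R6′) of `rightInvW`;
§3 the re-exports (R1), (R4), (R5).

HONEST FRAMING.  Kinematics of OUR objects; constants explicit and crude; nothing about minimisers; (P♮)_W, T-E_w and **NE3 are NOT proved**; spine
PROVED 0∕9; finite T⁴ rung (B)+1 — NOT infinite volume, NOT mass gap, NOT `BetaPertH`, NOT Clay.  PLACEMENT: `Summits/QuantumFields/BalabanUV/`.
HONEST DEPENDENCY (cell page 1): continuum YM on T⁴ ⇐ BetaPertH ∧ nine spine estimates (0/9 proved); BetaPertH ⇐ (D1) ∧ (D4) ∧ CAP+tail;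
G-an2-4 gates asym, D1 and NE2/3/4.
-/

set_option autoImplicit false

open scoped BigOperators Matrix.Norms.L2Operator
open Finset

namespace Summit.QuantumFields.BalabanUV.T4Continuum.NE3RightInverseLetters

open Literature.MathematicalPhysics.QuantumFieldTheory.Balaban1983to89
open B7Prop1Explicit B7Prop2Explicit
open T4AveragingDeficitWall (IsUnitaryCfg IsSkewDir SmallField curl curlSq dirSq dirL1)
open T4AveragingDeficitWallBoundary (IsPeriodicCfg periodBox)
open AveragingDeficitPeriodicCounting (IsPeriodicDir)
open AveragingDeficitMultiLevelPrep (cavgIter LevelSmall tower)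
open AveragingDeficitTwoLevelPrep (skewSub)
open AveragingDeficitTorusChart (TDir extDir isPeriodicDir_extDir)
open MinimalActionLevels (perWin)
open NE3TangentCovariantTower (dirIter)
open NE3CovariantLift (hatInvW)
open NE3QbarIterCovLiftPrep (cruxC)
open NE3SmoothRightInverseW (solveW resSkew rightInvW dirIter_rightInvW isSkewDir_rightInvW isPeriodicDir_rightInvW)
open NE3RightInverseSupLetters (supC norm_rightInvW_le)
open NE3RightInverseSolveLetters (thetaLoc dirSq_solve_le dirL1_solve_le norm_solve_le cruxC_le_thetaLoc)
open NE3RightInverseL2Letter (l2C dirSq_rightInvW_le)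
open NE3RightInverseL1Letter (l1C dirL1_rightInvW_le)
open NE3HatInvCurlLetters (supCurlC curl2C curl1C curl2C_nonneg curl1C_nonneg curlSq_hatInvW_le sum_norm_curl_hatInvW_le norm_curl_hatInvW_le_of_sup)

noncomputable section

variable {d : ℕ} {n : Type*} [Fintype n] [DecidableEq n]

section RightInv

variable [Nonempty n] {L : ℕ} (hL : 2 ≤ L) (k : ℕ) {N : ℕ} [NeZero N] {W : Site d → Fin d → (Matrix n n ℂ)ˣ} {x : ℝ}
  (hWu : IsUnitaryCfg W) (hWP : IsPeriodicCfg W ((tower L N (k + 1) : ℕ) : ℤ)) (hx : 0 ≤ x) (hs : LevelSmall d L k x) (hWx : SmallField W x)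
  (hθ : cruxC d L * (((L : ℝ) ^ (k + 1)) ^ 2 * x) < 1) (hθl : thetaLoc d L * (((L : ℝ) ^ (k + 1)) ^ 2 * x) < 1)
  (hε : ((L : ℝ) ^ (k + 1)) ^ 2 * x ≤ 1) {φ : Site d → Fin d → Matrix n n ℂ} (hφ : IsSkewDir φ) (hφP : IsPeriodicDir φ (N : ℤ))

/-! ## §1 Exactness, skewness, periodicity in the junction's spelling -/

include hWP hφP in
/-- **EXACTNESS**: `dirIter L (k+1) W (rightInvW … φ) = φ` (W5 `dirIter_rightInvW`, re-exported). [folklore] -/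
theorem rightInvW_exact : dirIter L (k + 1) W (rightInvW hL k hWu hx hs hWx N hθ hφ) = φ :=
  dirIter_rightInvW hL k hWu hWP hx hs hWx hθ hφ hφP

/-- **SKEWNESS** (W5, re-exported). [folklore] -/
theorem rightInvW_skew : IsSkewDir (rightInvW hL k hWu hx hs hWx N hθ hφ) := isSkewDir_rightInvW hL k hWu hx hs hWx hθ hφ

include hWP in
/-- **PERIODICITY in the junction's spelling**: `IsPeriodicDir (rightInvW … φ) (N * L^(k+1))`. [folklore] -/
theorem rightInvW_periodic : IsPeriodicDir (rightInvW hL k hWu hx hs hWx N hθ hφ) ((N * L ^ (k + 1) : ℕ) : ℤ) := by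
  have h := isPeriodicDir_rightInvW hL k hWu hWP hx hs hWx hθ hφ
  have hT : tower L N (k + 1) = N * L ^ (k + 1) := by rw [NE3FramePotBoundW.tower_eq_pow_mul, Nat.mul_comm]
  rwa [hT] at h

/-! ## §2 The curl letters (R2), (R3), (R6′) of the exact right inverse -/

include hWP hθl hε in
/-- **(R2)**: `curlSq W (rightInvW … φ) (periodBox (N·L^{k+1})) ≤ (curl2C ∕ (1 − θ_loc)²)·((L^{k+1})^d∕(L^{k+1})⁴)·dirSq φ (periodBox N)`. [folklore] -/
theorem curlSq_rightInvW_le :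
    curlSq W (rightInvW hL k hWu hx hs hWx N hθ hφ) (periodBox (d := d) (N * L ^ (k + 1)))
      ≤ (curl2C d L / (1 - thetaLoc d L * (((L : ℝ) ^ (k + 1)) ^ 2 * x)) ^ 2) * (((L : ℝ) ^ (k + 1)) ^ d / ((L : ℝ) ^ (k + 1)) ^ 4)
          * dirSq φ (periodBox (d := d) N) := by
  have h1 := curlSq_hatInvW_le hL k hWu hWP hx hs hWx hε
    (isPeriodicDir_extDir N ((solveW hL k hWu hx hs hWx N hθ (resSkew N hφ) : ↥(skewSub d n N)) : TDir d n N))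
  have h2 := dirSq_solve_le hL k hWu hx hs hWx N hθ hθl hφ
  have hpos : 0 < 1 - thetaLoc d L * (((L : ℝ) ^ (k + 1)) ^ 2 * x) := by linarith
  have hc : 0 ≤ curl2C d L * (((L : ℝ) ^ (k + 1)) ^ d / ((L : ℝ) ^ (k + 1)) ^ 4) := by have := curl2C_nonneg d L; positivity
  refine (show rightInvW hL k hWu hx hs hWx N hθ hφ = hatInvW L k W _ from rfl) ▸ h1.trans ?_
  refine (mul_le_mul_of_nonneg_left h2 hc).trans (le_of_eq ?_)
  field_simp

include hWP hθl hε in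
/-- **(R3)**: `Σ_{p∈perWin d (N·L^{k+1})} ‖curl W (rightInvW … φ) p‖ ≤ (curl1C ∕ (1 − θ_loc))·((L^{k+1})^d∕(L^{k+1})²)·dirL1 φ (periodBox N)`. [folklore] -/
theorem sum_norm_curl_rightInvW_le :
    ∑ p ∈ perWin d (N * L ^ (k + 1)), ‖curl W (rightInvW hL k hWu hx hs hWx N hθ hφ) p‖
      ≤ (curl1C d L / (1 - thetaLoc d L * (((L : ℝ) ^ (k + 1)) ^ 2 * x))) * (((L : ℝ) ^ (k + 1)) ^ d / ((L : ℝ) ^ (k + 1)) ^ 2)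
          * dirL1 φ (periodBox (d := d) N) := by
  have h1 := sum_norm_curl_hatInvW_le hL k hWu hWP hx hs hWx hε
    (isPeriodicDir_extDir N ((solveW hL k hWu hx hs hWx N hθ (resSkew N hφ) : ↥(skewSub d n N)) : TDir d n N))
  have h2 := dirL1_solve_le hL k hWu hx hs hWx N hθ hθl hφ
  have hpos : 0 < 1 - thetaLoc d L * (((L : ℝ) ^ (k + 1)) ^ 2 * x) := by linarith
  have hc : 0 ≤ curl1C d L * (((L : ℝ) ^ (k + 1)) ^ d / ((L : ℝ) ^ (k + 1)) ^ 2) := by have := curl1C_nonneg d L; positivity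
  refine (show rightInvW hL k hWu hx hs hWx N hθ hφ = hatInvW L k W _ from rfl) ▸ h1.trans ?_
  refine (mul_le_mul_of_nonneg_left h2 hc).trans (le_of_eq ?_)
  field_simp

include hε in
/-- **(R6′)**: for `‖φ‖_∞ ≤ s`, `‖curl W (rightInvW … φ) p‖ ≤ supCurlC ∕ ((L^{k+1})²·(1 − θ)) · s` on every plaquette (`θ = cruxC·ε`). [folklore] -/
theorem norm_curl_rightInvW_le {s : ℝ} (hs0 : 0 ≤ s) (hφs : ∀ (z : Site d) (κ : Fin d), ‖φ z κ‖ ≤ s) (p : T4AveragingDeficitWall.Plaq d) :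
    ‖curl W (rightInvW hL k hWu hx hs hWx N hθ hφ) p‖
      ≤ supCurlC d L / (((L : ℝ) ^ (k + 1)) ^ 2 * (1 - cruxC d L * (((L : ℝ) ^ (k + 1)) ^ 2 * x))) * s := by
  have hpos : 0 < 1 - cruxC d L * (((L : ℝ) ^ (k + 1)) ^ 2 * x) := by linarith
  have hS0 : 0 ≤ s / (1 - cruxC d L * (((L : ℝ) ^ (k + 1)) ^ 2 * x)) := by positivity
  have h := norm_curl_hatInvW_le_of_sup hL k hWu hx hs hWx hε _ hS0 (norm_solve_le hL k hWu hx hs hWx N hθ hφ hs0 hφs) p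
  refine (show rightInvW hL k hWu hx hs hWx N hθ hφ = hatInvW L k W _ from rfl) ▸ h.trans (le_of_eq ?_)
  field_simp

include hε in
/-- **(R6′) on the period window** (the junction's `haN` shape). [folklore] -/
theorem norm_curl_rightInvW_le_perWin {s : ℝ} (hs0 : 0 ≤ s) (hφs : ∀ (z : Site d) (κ : Fin d), ‖φ z κ‖ ≤ s) :
    ∀ p ∈ perWin d (N * L ^ (k + 1)), ‖curl W (rightInvW hL k hWu hx hs hWx N hθ hφ) p‖
      ≤ supCurlC d L / (((L : ℝ) ^ (k + 1)) ^ 2 * (1 - cruxC d L * (((L : ℝ) ^ (k + 1)) ^ 2 * x))) * s :=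
  fun p _ => norm_curl_rightInvW_le hL k hWu hx hs hWx hθ hε hφ hs0 hφs p

/-! ## §3 The ℓ-letters (R1), (R4), (R5), re-exported -/

include hWP hθl hε in
/-- **(R1)** (W6b `dirSq_rightInvW_le`). [folklore] -/
theorem rightInvW_R1 :
    dirSq (rightInvW hL k hWu hx hs hWx N hθ hφ) (periodBox (d := d) (N * L ^ (k + 1)))
      ≤ (l2C d L / (1 - thetaLoc d L * (((L : ℝ) ^ (k + 1)) ^ 2 * x)) ^ 2) * (((L : ℝ) ^ (k + 1)) ^ d / ((L : ℝ) ^ (k + 1)) ^ 2)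
          * dirSq φ (periodBox (d := d) N) :=
  dirSq_rightInvW_le hL k hWu hWP hx hs hWx hθ hθl hε hφ

include hWP hθl hε in
/-- **(R4)** (W6d `dirL1_rightInvW_le`). [folklore] -/
theorem rightInvW_R4 :
    dirL1 (rightInvW hL k hWu hx hs hWx N hθ hφ) (periodBox (d := d) (N * L ^ (k + 1)))
      ≤ (l1C d L / (1 - thetaLoc d L * (((L : ℝ) ^ (k + 1)) ^ 2 * x))) * (((L : ℝ) ^ (k + 1)) ^ d / (L : ℝ) ^ (k + 1))
          * dirL1 φ (periodBox (d := d) N) :=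
  dirL1_rightInvW_le hL k hWu hWP hx hs hWx hθ hθl hε hφ

include hε in
/-- **(R5)** (W6a `norm_rightInvW_le`). [folklore] -/
theorem rightInvW_R5 {s : ℝ} (hs0 : 0 ≤ s) (hφs : ∀ (z : Site d) (κ : Fin d), ‖φ z κ‖ ≤ s) (y : Site d) (μ : Fin d) :
    ‖rightInvW hL k hWu hx hs hWx N hθ hφ y μ‖ ≤ supC d L / ((L : ℝ) ^ (k + 1) * (1 - cruxC d L * (((L : ℝ) ^ (k + 1)) ^ 2 * x))) * s :=
  norm_rightInvW_le hL k hWu hx hs hWx N hθ hε hφ hs0 hφs y μ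

/-- The sup binder follows from the local one: `cruxC·ε ≤ thetaLoc·ε`, so `thetaLoc·ε < 1 → cruxC·ε < 1`. [folklore] -/
theorem theta_lt_one_of_loc {L : ℕ} (k : ℕ) {x : ℝ} (hx : 0 ≤ x) (hθl : thetaLoc d L * (((L : ℝ) ^ (k + 1)) ^ 2 * x) < 1) :
    cruxC d L * (((L : ℝ) ^ (k + 1)) ^ 2 * x) < 1 :=
  lt_of_le_of_lt (mul_le_mul_of_nonneg_right (cruxC_le_thetaLoc d L) (by positivity)) hθl

end RightInv

end

end Summit.QuantumFields.BalabanUV.T4Continuum.NE3RightInverseLetters
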